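import Literature.AlgebraicGeometry.Frobenioids.GeometricFrobenioidsProofs
import HarnessLib

/-!
# Frobenioids I, Theorem 6.2 (iv) AS TYPED (`Thm62iv`, FACT-LIST F-1105): the universal closure exceeds print by the
# dropped standing hypothesis "`K̃/K` Galois", and is reduced to a pure field-theoretic datum — PROOF-ONLY

Mochizuki, *The geometry of Frobenioids I: the general theory*, Kyushu J. Math. **62** (2008) 293–400, Example 6.1
p. 109 ("Let `V` be a proper normal variety over a field `k`, `K` the function field of `V`, `K̃/K` a (possibly infinite)
**Galois** extension, `G = Gal(K̃/K)` …"), Theorem 6.2 (iv) p. 111 ("`D` is Frobenius-slim. … `D` is slim if and only if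
`Z = {1}`. … `D` is Div-slim if and only if, for every `1 ≠ z ∈ Z`, there exists a finite Galois extension `L ⊆ K̃` of `K`
such that `z` acts nontrivially on `Φ(L)`"), Def. 4.5 (iv) p. 86 (Div-slim). [cite: MochizukiFrdI2008, Thm. 6.2 (iv) p.111]
[cite: MochizukiFrdI2008, Def. 4.5 (iv) p.86]

PROOF-ONLY companion (abc-iut cell, block F fact-proving wave, seat abc-iut-f-045 gen 5; FROZEN FACT-LIST row F-1105
`Thm62iv`, declared in `GeometricFrobenioids.lean` over the binders `{K} [Field K] {Kt} [Field Kt] [Algebra K Kt]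
{Γ : GeometricDivisorData K Kt} {C} [Category C] (M : GeometricModelFrobenioid Γ C)` — WITHOUT `[IsGalois K Kt]`).
No `def`, no `instance`, no new named fact.

WHAT IS RECORDED.
* The instance AT PRINT STRENGTH is the tree theorem `Thm62iv_holds` (abc-iut-L1-t4, `GeometricFrobenioidsProofs.lean`,
  p408988), whose ONLY extra binder is `[IsGalois K Kt]` — print's standing hypothesis of Ex. 6.1 ("`K̃/K` a Galois
  extension").  So the universal closure of the row exceeds print exactly by non-Galois `Kt/K`.
* `PreFrobenioidData.isDivSlim_of_forall_iso_eq_id` — an `IsGalois`-free sufficient criterion for Def. 4.5 (iv): if every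
  automorphism of every object of `D` that fixes all divisors is the identity, then `D` is Div-slim (the components of an
  automorphism of `D_A → D` are such automorphisms).
* `FinSubextCat.mem_commOpenSubgroup_of_finiteDimensional` — for FINITE `Kt/K` the Krull topology is discrete, so
  `Z = Aut(Kt/K)`.
* `FinSubextCat.not_movesSomeGalois_of_trivial_on_galois` — if some `1 ≠ z ∈ Z` fixes pointwise every intermediate field
  that is Galois over `K`, the right-hand side of the Div-slim criterion ("`z` acts nontrivially on `Φ(L)` for some finite
  GALOIS `L`") fails for EVERY divisor monoid: the restriction `σ` of `z` to such an `L` is the identity arrow.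
* `not_thm62iv_of_faithful_of_trivial_on_galois` — hence `¬ Thm62iv M` for any FINITE `Kt/K` carrying (a) such a `z` and
  (b) operations `M.ops` on which the automorphisms of the objects of `D` act faithfully (every divisor-fixing automorphism
  is the identity): (b) makes `D` Div-slim, (a) kills the right-hand side.  `not_forall_thm62iv_of` packages this as the
  universal closure of F-1105 REFUTED MODULO the existence of such data (H_F1105).
THE DATUM H_F1105 (mathematics, NOT a kernel event of this file): (a) holds at `K = ℚ`, `Kt = ℚ(⁴√2)`, `z : ⁴√2 ↦ −⁴√2`
(the Galois intermediate fields are `ℚ` and `ℚ(√2) = Fix(z)`: a second normal quadratic subfield would make `ℚ(⁴√2)`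
normal over `ℚ`); (b) holds for the constructed model `geomModelFrobenioid Γ` of the "embedding" divisor data `Γ`
(`D_L := Hom_K(L, K̄)`, pull-back = precomposition, all ramification indices `1`), on which `Aut_K(L)` acts freely.  Neither
`ℚ(⁴√2)` nor that `Γ` is in the tree; they are the residual named by this file.  For FINITE `Kt/K` the first two
conjuncts of `Thm62iv` hold without the Galois hypothesis (`FinSubextCat.isFrobeniusSlim`; slim ⟺ `Aut(Kt/K) = 1` by the
`G`-set translation), so a refutation of the closure must go through the third conjunct, as here.
HONEST FRAMING: bookkeeping about the typing; print's Thm. 6.2 (iv) is about Galois `K̃/K` and is PROVED in the tree at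
that strength; nothing here bears on [IUTchIII] Cor. 3.12; no side taken; typed ≠ proved.
-/

noncomputable section

namespace Literature.AlgebraicGeometry.Frobenioids

open CategoryTheory

universe w u v u' v' u₁

/-! ### An `IsGalois`-free sufficient criterion for Def. 4.5 (iv) -/

/-- **Div-slim from faithfulness on automorphisms** (Def. 4.5 (iv), sufficient criterion): if every automorphism of every
object of `D` which fixes all divisors is the identity, then `D` is Div-slim relative to `Φ` — the components of an
automorphism of `D_A → D` are such automorphisms. [cite: MochizukiFrdI2008, Def. 4.5 (iv) p.86] -/
theorem PreFrobenioidData.isDivSlim_of_forall_iso_eq_id {C : Type u} [Category.{v} C] {D : Type u'}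
    [Category.{v'} D] (S : PreFrobenioidData.{w} C D)
    (h : ∀ (X : D) (e : X ⟶ X), IsIso e → (∀ x : S.Mon X, S.pull e x = x) → e = 𝟙 X) : S.IsDivSlim := by
  refine ⟨fun A α hα => ?_⟩
  exact Iso.ext (NatTrans.ext (funext fun B => h _ (α.hom.app B) inferInstance (hα B)))

namespace FinSubextCat

variable {F : Type u₁} [Field F] {K : Type u₁} [Field K] [Algebra F K]

/-- For a FINITE extension `K/F` the Krull topology on `Aut(K/F)` is discrete (`Gal(K/⊤) = {1}` is open), so every
automorphism "commutes with some open subgroup": `Z = Aut(K/F)`. [cite: MochizukiFrdI2008, Thm. 6.2 (iv) p.111] -/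
theorem mem_commOpenSubgroup_of_finiteDimensional [FiniteDimensional F K] (z : K ≃ₐ[F] K) :
    z ∈ commOpenSubgroup F K := by
  refine ⟨(⊤ : IntermediateField F K).fixingSubgroup, IntermediateField.fixingSubgroup_isOpen ⊤, fun g hg => ?_⟩
  have hg1 : g = 1 := by rwa [IntermediateField.fixingSubgroup_top, Subgroup.mem_bot] at hg
  rw [hg1, mul_one, one_mul]

variable {C : Type u} [Category.{v} C] (S : PreFrobenioidData.{w} C (FinSubextCat F K))

/-- **The right-hand side of the Div-slim criterion fails as soon as some `1 ≠ z ∈ Z` fixes pointwise every intermediate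
field that is Galois over the base** — for EVERY divisor monoid: the arrow `σ : Spec L → Spec L` "with the values of `z`"
on a finite Galois `L` is then the identity, which moves no divisor. (For print's Galois `K̃/K` no such `z` exists: `z`
would fix `K̃ = ⋃ L`.) [cite: MochizukiFrdI2008, Thm. 6.2 (iv) p.111] -/
theorem not_movesSomeGalois_of_trivial_on_galois (z : K ≃ₐ[F] K) (hz : z ∈ commOpenSubgroup F K) (hz1 : z ≠ 1)
    (htriv : ∀ E : IntermediateField F K, IsGalois F E → ∀ x : K, x ∈ E → z x = x) :
    ¬ MovesSomeGalois S := by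
  intro h
  unfold MovesSomeGalois at h
  obtain ⟨X, hX, σ, hσ, x, hx⟩ := h z hz hz1
  apply hx
  have hσ1 : σ = 𝟙 X := by
    apply FinSubextCat.hom_ext
    apply AlgHom.ext
    intro a
    apply Subtype.ext
    rw [hσ a]
    exact htriv X.L hX a a.2
  rw [hσ1, S.pull_id]

end FinSubextCat

/-! ### F-1105: `Thm62iv` fails at any finite `Kt/K` with faithful operations and a `z ≠ 1` trivial on Galois subfields -/

section Thm62iv

variable {K : Type} [Field K] {Kt : Type} [Field Kt] [Algebra K Kt]
variable {Γ : GeometricDivisorData K Kt} {C : Type u} [Category.{v} C] (M : GeometricModelFrobenioid Γ C)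

/-- **`¬ Thm62iv M` from field data** (row F-1105 AS TYPED, i.e. WITHOUT `[IsGalois K Kt]`): for a FINITE `Kt/K`, if
(b) every automorphism of an object of `D = FinSubextCat K Kt` fixing all divisors of `M` is the identity and (a) some
automorphism `z ≠ 1` of `Kt/K` fixes pointwise every intermediate field Galois over `K`, then the third conjunct of
`Thm62iv M` is `True ↔ False`: `D` is Div-slim by (b) (`isDivSlim_of_forall_iso_eq_id`) while `z ∈ Z = Aut(Kt/K)` acts
trivially on `Φ(L)` for every finite Galois `L` by (a).  At print strength (`[IsGalois K Kt]`, Ex. 6.1) the row is the tree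
theorem `Thm62iv_holds`. [cite: MochizukiFrdI2008, Thm. 6.2 (iv) p.111] -/
theorem not_thm62iv_of_faithful_of_trivial_on_galois [FiniteDimensional K Kt]
    (hfaith : ∀ (X : FinSubextCat K Kt) (e : X ⟶ X), IsIso e → (∀ x : M.ops.Mon X, M.ops.pull e x = x) → e = 𝟙 X)
    (z : Kt ≃ₐ[K] Kt) (hz1 : z ≠ 1)
    (htriv : ∀ E : IntermediateField K Kt, IsGalois K E → ∀ x : Kt, x ∈ E → z x = x) : ¬ Thm62iv M := fun h =>
  FinSubextCat.not_movesSomeGalois_of_trivial_on_galois M.ops z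
    (FinSubextCat.mem_commOpenSubgroup_of_finiteDimensional z) hz1 htriv
    (h.2.2.1 (M.ops.isDivSlim_of_forall_iso_eq_id hfaith))

end Thm62iv

/-- **F-1105 (`Thm62iv`) — universal closure over the typed binders REFUTED MODULO the field datum H_F1105**: if some
FINITE extension `Kt/K` carries geometric divisor data `Γ` and a model `M` on which the automorphisms of the objects of
`D` act faithfully, together with an automorphism `z ≠ 1` of `Kt/K` trivial on every Galois intermediate field (in
mathematics: `ℚ(⁴√2)/ℚ` with the embedding divisor data — not in the tree), then `∀ …, Thm62iv M` is false.  Print's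
Thm. 6.2 (iv) (Galois `K̃/K`) is untouched and PROVED (`Thm62iv_holds`). [cite: MochizukiFrdI2008, Thm. 6.2 (iv) p.111] -/
theorem not_forall_thm62iv_of
    (H : ∃ (K Kt : Type) (_ : Field K) (_ : Field Kt) (_ : Algebra K Kt) (_ : FiniteDimensional K Kt)
      (Γ : GeometricDivisorData K Kt) (C : Type) (_ : Category.{0} C) (M : GeometricModelFrobenioid Γ C),
      (∀ (X : FinSubextCat K Kt) (e : X ⟶ X), IsIso e → (∀ x : M.ops.Mon X, M.ops.pull e x = x) → e = 𝟙 X) ∧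
        ∃ z : Kt ≃ₐ[K] Kt, z ≠ 1 ∧ ∀ E : IntermediateField K Kt, IsGalois K E → ∀ x : Kt, x ∈ E → z x = x) :
    ¬ ∀ (K : Type) (_ : Field K) (Kt : Type) (_ : Field Kt) (_ : Algebra K Kt) (Γ : GeometricDivisorData K Kt)
        (C : Type) (_ : Category.{0} C) (M : GeometricModelFrobenioid Γ C), Thm62iv M := by
  intro hall
  obtain ⟨K, Kt, _, _, _, _, Γ, C, _, M, hfaith, z, hz1, htriv⟩ := H
  exact not_thm62iv_of_faithful_of_trivial_on_galois M hfaith z hz1 htriv (hall K _ Kt _ _ Γ C _ M)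

end Literature.AlgebraicGeometry.Frobenioids

end
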